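import Literature.Probability.Percolation.TriLowestCrossingPairs
import Literature.Combinatorics.SimpleGraph.MengerTwo
import Literature.Probability.Percolation.OneArmLSW
import HarnessLib

/-!
# Rerouting two disjoint same-colour crossings along two distinct lowest crossings, disjointly

Topic: Probability / Percolation; family `crit-perc` (planar combinatorics of site percolation on
`𝕋`, in the abstract `JDomain` setting of `TriLowestCrossing.lean`). The deterministic core of the
separation step for two CONSECUTIVE ARMS OF THE SAME COLOUR in Nolin's arm-separation theorem for
the adjacent arrangement (P. Nolin, *Near-critical percolation in two dimensions*, EJP 13 (2008),
Thm. 11, `j = 4`, `σ = BBWW` [arXiv 0711.4948: Thm. 10]; §4.4, proof of Lemma 15 [arXiv Lemma 14],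
last paragraph: "we replace recursively the tip of each `c'_v` by the tip of one of the `c_u`'s …
Consider then `c'_2`, and `c_{v_2}` the lowest crossing it intersects: necessarily `v_2 > v_1`"),
the last missing input (`hsepAdj`) of the tree's proof of Werner's Lemma 6.3 for the order-free
`π̂_t`. The printed recipe (replace the tip of each crossing after its LAST intersection with the
lowest term it meets) does not always give disjoint crossings; this file proves a recipe that does.

**Setting.** `Q` a `JDomain` with `CutProp`, `DualProp`; a configuration `ω` with exploration
sequence `c₀ < c₁ < ⋯` (`lowestSeq`); two disjoint open crossings given as self-avoiding `𝕋`-walks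
`α₁ : s₁ ⇝ w₁` (self-avoiding), `α₂ : s₂ ⇝ w₂`, from a start site `s₁ ∈ F`, to their tips, `ht w₁ < ht w₂` (so `α₂`
lies above `α₁`); `u₁ < u₂` the least indices of terms meeting them (`pair_min_terms`).

**Recipe** (`pair_reroute`). Upper crossing: follow a path `π` inside `c_{u₂}` from its tip `z_{u₂}`
to its first contact `e` with `α₂`; the new upper crossing is `α₂[s₂ → e] ∪ π`. Lower crossing: if
`π` misses `α₁`, follow `c_{u₁}` from its tip to its first contact with `α₁` (the terms `c_{u₁}`,
`c_{u₂}` are disjoint, `α₂` misses `c_{u₁}`, `π` misses `α₁`). If `π` meets `α₁`, let `g` be the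
FIRST vertex of `α₁` on `π`; then the initial segment `α₁[s₁ → g]` meets the previous term
`c_{u₂-1}` — otherwise `α₁[s₁ → g] ∪ π[z_{u₂} → g]` would be an open crossing with the tip of
`c_{u₂}`, above `c_{u₂-1}` and disjoint from `α₂`, which the obstruction lemma
`disjoint_of_stage_crossing_same_tip` excludes (`α₂` meets `c_{u₂}`); let `h` be its LAST vertex on
`c_{u₂-1}`; the new lower crossing is `α₁[s₁ → h]` continued inside `c_{u₂-1}` to its tip. All
contacts of `π` with `α₁` come after `h`, `c_{u₂-1}` misses `α₂` and `c_{u₂}`: the two new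
crossings are disjoint. In both cases the lower one ends at the tip of a term of index `< u₂`, above
which the whole upper one lies (the input of the tip-spacing argument,
`ArmSeparationExclusion.lean`), and each old tip is joined to its new tip inside (old crossing ∪ its
term) (the input of the order certificate, `AdjacentPatternTransfer.lean`).

Everything here is proved; no named facts are introduced.

## References

* P. Nolin, Near-critical percolation in two dimensions, *Electron. J. Probab.* 13 (2008), §4.4,
  proof of Lemma 15 (arXiv 0711.4948: Lemma 14, last paragraph) [Nolin2008].
* H. Kesten, *Percolation theory for mathematicians*, Birkhäuser (1982), §2.3 [KestenPTM1982].
* R. Diestel, *Graph Theory*, 5th ed. (2017), §1.3 (walk surgery) [Diestel2017].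

## Mathlib / tree

Tree: `pair_min_terms`, `disjoint_of_stage_crossing_same_tip`, `subset_above_of_forall_disjoint`,
`lowestSeq_subset_above_of_lt`, `IsCrossing.subset_above_of_mem`, `IsCrossing.ht_lt_of_mem_above`
(`TriLowestCrossingPairs.lean`); the `JDomain` toolkit (`TriLowestCrossing.lean`);
`exists_append_first_mem`, `exists_append_last_mem`, `isPath_append_iff'`
(`Literature/Combinatorics/SimpleGraph/MengerTwo.lean`); `PathIn.of_walk`,
`PathIn.of_walk_mem_support`, `PathIn.exists_walk`. Mathlib: `SimpleGraph.Walk.takeUntil/dropUntil`,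
`take_spec`, `support_takeUntil_subset`, `bypass`, `bypass_isPath`, `support_bypass_subset`.
-/

noncomputable section

open Set

namespace Literature.Probability.Percolation

open LatticeModels Literature.Combinatorics.SimpleGraph

namespace JDomain

variable {Q : JDomain}

/-! ### Small walk facts -/

/-- The support of the first half of a concatenation. [folklore] -/
theorem support_subset_support_append_left {u v w : Site 2} (p : triGraph.Walk u v) (q : triGraph.Walk v w) :
    ∀ y ∈ p.support, y ∈ (p.append q).support := fun y hy => by
  rw [SimpleGraph.Walk.mem_support_append_iff]; exact Or.inl hy

/-- The support of the second half of a concatenation. [folklore] -/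
theorem support_subset_support_append_right {u v w : Site 2} (p : triGraph.Walk u v) (q : triGraph.Walk v w) :
    ∀ y ∈ q.support, y ∈ (p.append q).support := fun y hy => by
  rw [SimpleGraph.Walk.mem_support_append_iff]; exact Or.inr hy

/-- In a path `p ++ q`, a vertex of `q` lying on `p` is the junction. [folklore] -/
theorem eq_of_mem_support_of_isPath_append {u v w : Site 2} {p : triGraph.Walk u v} {q : triGraph.Walk v w}
    (h : (p.append q).IsPath) {y : Site 2} (hyp : y ∈ p.support) (hyq : y ∈ q.support) : y = v :=
  (isPath_append_iff'.1 h).2.2 y hyp hyq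

/-- A walk inside a finite set `c` between two of its sites, as a self-avoiding walk. [folklore] -/
theorem exists_isPath_of_pathIn {c : Finset (Site 2)} {x y : Site 2} (h : PathIn triGraph (↑c : Set (Site 2)) x y) :
    ∃ p : triGraph.Walk x y, p.IsPath ∧ ∀ v ∈ p.support, v ∈ c := by
  obtain ⟨w, hw⟩ := PathIn.exists_walk h
  exact ⟨w.bypass, w.bypass_isPath, fun v hv => Finset.mem_coe.1 (hw v (w.support_bypass_subset_support hv))⟩

/-- The support of a self-avoiding closed walk is its base point. [folklore] -/
theorem eq_of_mem_support_of_isPath_loop {u g : Site 2} {p : triGraph.Walk u u} (hp : p.IsPath) (hg : g ∈ p.support) :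
    g = u := by
  cases p with
  | nil => simpa using hg
  | cons h q => exact absurd q.end_mem_support ((SimpleGraph.Walk.cons_isPath_iff h q).1 hp).2

/-! ### The rerouting theorem -/

/-- **Disjoint rerouting of two disjoint same-colour crossings along two distinct terms** (the
corrected form of Nolin's tip replacement for consecutive arms of the same colour). See the module
docstring for the recipe. Output: an index `u < u₂` with its term `(c, z)`, met by `α₁`, above which
lie `α₂` and `c_{u₂}`, and disjoint finite sets `P₁ ⊆ α₁ ∪ c`, `P₂ ⊆ α₂ ∪ c_{u₂}` carrying `𝕋`-paths
from `s₁` to `z` and from `s₂` to `z₂`. [cite: Nolin2008, §4.4 (arXiv 0711.4948: proof of Lemma 14, last paragraph, "necessarily v₂ > v₁")] -/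
theorem pair_reroute (hcut : Q.CutProp) (hdual : Q.DualProp) {ω : Set (Site 2)}
    {s₁ w₁ s₂ w₂ : Site 2} (α₁ : triGraph.Walk s₁ w₁) (α₂ : triGraph.Walk s₂ w₂)
    (hα₁ : α₁.IsPath)
    (ha₁ : Q.IsCrossing α₁.support.toFinset w₁) (ha₂ : Q.IsCrossing α₂.support.toFinset w₂)
    (hs₁ : s₁ ∈ Q.F)
    (ha₁ω : (↑α₁.support.toFinset : Set (Site 2)) ⊆ ω) (ha₂ω : (↑α₂.support.toFinset : Set (Site 2)) ⊆ ω)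
    (hdisj : Disjoint α₁.support.toFinset α₂.support.toFinset) (hlt : Q.ht w₁ < Q.ht w₂)
    {u₁ u₂ : ℕ} {c₁ c₂ : Finset (Site 2)} {z₁ z₂ : Site 2}
    (hu₁ : Q.lowestSeq ω u₁ = some (c₁, z₁)) (hmeet₁ : (α₁.support.toFinset ∩ c₁).Nonempty)
    (hmin₁ : ∀ v < u₁, ∀ c z, Q.lowestSeq ω v = some (c, z) → Disjoint α₁.support.toFinset c)
    (hu₂ : Q.lowestSeq ω u₂ = some (c₂, z₂)) (hmeet₂ : (α₂.support.toFinset ∩ c₂).Nonempty)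
    (hmin₂ : ∀ v < u₂, ∀ c z, Q.lowestSeq ω v = some (c, z) → Disjoint α₂.support.toFinset c) :
    ∃ (u : ℕ) (c : Finset (Site 2)) (z : Site 2), Q.lowestSeq ω u = some (c, z) ∧ u < u₂ ∧
      (α₁.support.toFinset ∩ c).Nonempty ∧ α₂.support.toFinset ⊆ Q.above c z ∧ c₂ ⊆ Q.above c z ∧
      ∃ P₁ P₂ : Finset (Site 2), Disjoint P₁ P₂ ∧
        P₁ ⊆ α₁.support.toFinset ∪ c ∧ P₂ ⊆ α₂.support.toFinset ∪ c₂ ∧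
        PathIn triGraph (↑P₁ : Set (Site 2)) s₁ z ∧ PathIn triGraph (↑P₂ : Set (Site 2)) s₂ z₂ := by
  classical
  set a₁ := α₁.support.toFinset with ha₁def
  set a₂ := α₂.support.toFinset with ha₂def
  have mem₁ : ∀ {x}, x ∈ a₁ ↔ x ∈ α₁.support := fun {x} => List.mem_toFinset
  have mem₂ : ∀ {x}, x ∈ a₂ ↔ x ∈ α₂.support := fun {x} => List.mem_toFinset
  have hdj : ∀ {x}, x ∈ α₁.support → x ∉ α₂.support := fun {x} h1 h2 =>
    Finset.disjoint_left.1 hdisj (mem₁.2 h1) (mem₂.2 h2)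
  obtain ⟨h21, -, hA₁, hd21, h2c₁, hL₂, hu12⟩ :=
    pair_min_terms hcut hdual ha₁ ha₁ω ha₂ ha₂ω hdisj hlt hu₁ hmin₁ hu₂ hmeet₂ hmin₂
  obtain ⟨hc₁, hc₁ω⟩ := isCrossing_of_lowestSeq hu₁
  obtain ⟨hc₂, hc₂ω⟩ := isCrossing_of_lowestSeq hu₂
  have hc12 : Disjoint c₁ c₂ := lowestSeq_disjoint_of_lt hcut hu12 hu₁ hu₂
  have hc2c1 : c₂ ⊆ Q.above c₁ z₁ := lowestSeq_subset_above_of_lt hcut hu12 hu₁ hu₂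
  -- the path `π` inside `c₂` from its tip to its first contact `e` with `α₂`
  obtain ⟨x₂, hx₂⟩ := hmeet₂
  have hx₂a : x₂ ∈ a₂ := (Finset.mem_inter.1 hx₂).1
  have hx₂c : x₂ ∈ c₂ := (Finset.mem_inter.1 hx₂).2
  obtain ⟨π₀, hπ₀, hπ₀c⟩ := exists_isPath_of_pathIn (hc₂.conn z₂ hc₂.tip_mem x₂ hx₂c)
  obtain ⟨e, π, πr, hπeq, heL, hefirst⟩ := exists_append_first_mem (↑a₂ : Set (Site 2)) π₀
    ⟨x₂, π₀.end_mem_support, Finset.mem_coe.2 hx₂a⟩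
  have hea : e ∈ a₂ := Finset.mem_coe.1 heL
  have hea' : e ∈ α₂.support := mem₂.1 hea
  have hπsub : ∀ v ∈ π.support, v ∈ π₀.support := fun v hv => by rw [hπeq]; exact support_subset_support_append_left π πr v hv
  have hπc : ∀ v ∈ π.support, v ∈ c₂ := fun v hv => hπ₀c v (hπsub v hv)
  have hπpath : π.IsPath := by rw [hπeq] at hπ₀; exact (isPath_append_iff'.1 hπ₀).1
  have hπa₂ : ∀ v ∈ π.support, v ∈ α₂.support → v = e := fun v hv hva => hefirst v hv (Finset.mem_coe.2 (mem₂.2 hva))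
  -- the new upper crossing
  set β₂ := α₂.takeUntil e hea' with hβ₂
  set P₂ : Finset (Site 2) := β₂.support.toFinset ∪ π.support.toFinset with hP₂
  have hP₂sub : P₂ ⊆ a₂ ∪ c₂ := by
    intro v hv
    rcases Finset.mem_union.1 hv with h | h
    · exact Finset.mem_union_left _ (mem₂.2 (α₂.support_takeUntil_subset_support hea' (List.mem_toFinset.1 h)))
    · exact Finset.mem_union_right _ (hπc v (List.mem_toFinset.1 h))
  have hP₂path : PathIn triGraph (↑P₂ : Set (Site 2)) s₂ z₂ := by
    refine PathIn.of_walk (β₂.append π.reverse) fun v hv => ?_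
    rw [SimpleGraph.Walk.mem_support_append_iff] at hv
    rw [Finset.mem_coe, hP₂, Finset.mem_union, List.mem_toFinset, List.mem_toFinset]
    rcases hv with h | h
    · exact Or.inl h
    · right; rwa [SimpleGraph.Walk.support_reverse, List.mem_reverse] at h
  ----------------------------------------------------------------------------------------------
  by_cases hhit : ∃ y ∈ π.support, y ∈ α₁.support
  · ------------------------------------------------------------------------------------------
    -- CASE: `π` meets `α₁`; `g` = the first vertex of `α₁` on `π`
    ------------------------------------------------------------------------------------------
    obtain ⟨g, β, β', hαeq, hgL, hgfirst⟩ := exists_append_first_mem {v : Site 2 | v ∈ π.support} α₁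
      (by obtain ⟨y, hy, hya⟩ := hhit; exact ⟨y, hya, hy⟩)
    have hgπ : g ∈ π.support := hgL
    have hβsub : ∀ v ∈ β.support, v ∈ α₁.support := fun v hv => by rw [hαeq]; exact support_subset_support_append_left β β' v hv
    have hβpath : (β.append β').IsPath := by rw [← hαeq]; exact hα₁
    have hga₁ : g ∈ α₁.support := hβsub g β.end_mem_support
    have hge : g ≠ e := fun h => hdj hga₁ (h ▸ hea')
    have hgc₂ : g ∈ c₂ := hπc g hgπ
    -- `u₂ = u' + 1` and the previous term
    obtain ⟨u', rfl⟩ : ∃ u', u₂ = u' + 1 := ⟨u₂ - 1, by omega⟩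
    obtain ⟨⟨c', z'⟩, hu'⟩ := exists_lowestSeq_eq_some_of_succ hu₂
    obtain ⟨hc', hc'ω⟩ := isCrossing_of_lowestSeq hu'
    have hc2c' : c₂ ⊆ Q.above c' z' := (lowestSeq_succ_subset_above hcut hu' hu₂).1
    have hc'c₂ : Disjoint c' c₂ := lowestSeq_disjoint_of_lt hcut (Nat.lt_succ_self u') hu' hu₂
    have hc'a₂ : Disjoint a₂ c' := hmin₂ u' (Nat.lt_succ_self u') c' z' hu'
    -- the initial segment `β` meets `c'`
    have hβc' : ∃ y ∈ β.support, y ∈ (↑c' : Set (Site 2)) := by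
      by_contra hno
      push Not at hno
      have hβdisj : Disjoint β.support.toFinset c' :=
        Finset.disjoint_left.2 fun v hv hvc => hno v (List.mem_toFinset.1 hv) (Finset.mem_coe.2 hvc)
      -- the crossing `K = β ∪ π[z₂ → g]` with tip `z₂`
      set πg := π.takeUntil g hgπ with hπg
      have hπgsub : ∀ v ∈ πg.support, v ∈ π.support := fun v hv => π.support_takeUntil_subset_support hgπ hv
      have heπg : e ∉ πg.support := by
        intro h
        have hsp := π.take_spec hgπ
        have hp : (πg.append (π.dropUntil g hgπ)).IsPath := by rw [hπg, hsp]; exact hπpath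
        exact hge (eq_of_mem_support_of_isPath_append hp h (π.dropUntil g hgπ).end_mem_support).symm
      set K : Finset (Site 2) := β.support.toFinset ∪ πg.support.toFinset with hK
      have hKmem : ∀ {v}, v ∈ K ↔ v ∈ β.support ∨ v ∈ πg.support := fun {v} => by
        rw [hK, Finset.mem_union, List.mem_toFinset, List.mem_toFinset]
      have hKD : K ⊆ Q.D := fun v hv => by
        rcases hKmem.1 hv with h | h
        · exact ha₁.subset (mem₁.2 (hβsub v h))
        · exact hc₂.subset (hπc v (hπgsub v h))
      have hKconn : ∀ x ∈ K, ∀ y ∈ K, PathIn triGraph (↑K : Set (Site 2)) x y := by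
        have toG : ∀ x ∈ K, PathIn triGraph (↑K : Set (Site 2)) x g := by
          intro x hx
          rcases hKmem.1 hx with h | h
          · exact (PathIn.of_walk_mem_support β (fun v hv => Finset.mem_coe.2 (hKmem.2 (Or.inl hv))) h).2
          · exact (PathIn.of_walk_mem_support πg (fun v hv => Finset.mem_coe.2 (hKmem.2 (Or.inr hv))) h).2
        exact fun x hx y hy => (toG x hx).trans (toG y hy).symm
      have hK : Q.IsCrossing K z₂ :=
        { subset := hKD
          tip_mem := hKmem.2 (Or.inr πg.start_mem_support)
          tip_mem_J := hc₂.tip_mem_J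
          eq_tip := by
            intro v hv hvJ
            rcases hKmem.1 hv with h | h
            · -- a site of `J` on `α₁` is `w₁`; on `β` it is then `g`, on `π`, hence `z₂`
              have hvw : v = w₁ := ha₁.eq_tip v (mem₁.2 (hβsub v h)) hvJ
              subst hvw
              have hvg : v = g := eq_of_mem_support_of_isPath_append hβpath h β'.end_mem_support
              rw [hvg] at hvJ ⊢
              exact hc₂.eq_tip g hgc₂ hvJ
            · exact hc₂.eq_tip v (hπc v (hπgsub v h)) hvJ
          exists_start := ⟨s₁, hKmem.2 (Or.inl β.start_mem_support), hs₁⟩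
          conn := hKconn }
      have hKω : (↑K : Set (Site 2)) ⊆ ω := by
        intro v hv
        rcases hKmem.1 (Finset.mem_coe.1 hv) with h | h
        · exact ha₁ω (Finset.mem_coe.2 (mem₁.2 (hβsub v h)))
        · exact hc₂ω (Finset.mem_coe.2 (hπc v (hπgsub v h)))
      have hKabove : ∀ v c'' z'', v + 1 = u' + 1 → Q.lowestSeq ω v = some (c'', z'') → K ⊆ Q.above c'' z'' := by
        intro v c'' z'' hv hseq
        have hvu : v = u' := by omega
        subst hvu
        rw [hu'] at hseq
        obtain ⟨rfl, rfl⟩ := Prod.mk.inj (Option.some.inj hseq)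
        intro x hx
        rcases hKmem.1 hx with h | h
        · -- `β` is connected, off `c'`, and contains `g ∈ c₂ ⊆ above c'`
          have hβD : β.support.toFinset ⊆ Q.D := fun v hv => ha₁.subset (mem₁.2 (hβsub v (List.mem_toFinset.1 hv)))
          have hβconn : ∀ x ∈ β.support.toFinset, ∀ y ∈ β.support.toFinset,
              PathIn triGraph (↑β.support.toFinset : Set (Site 2)) x y := by
            intro x hx y hy
            have px := (PathIn.of_walk_mem_support β (fun v hv => Finset.mem_coe.2 (List.mem_toFinset.2 hv)) (List.mem_toFinset.1 hx)).1
            have py := (PathIn.of_walk_mem_support β (fun v hv => Finset.mem_coe.2 (List.mem_toFinset.2 hv)) (List.mem_toFinset.1 hy)).1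
            exact px.symm.trans py
          exact hc'.subset_above_of_mem hβD hβconn hβdisj (List.mem_toFinset.2 β.end_mem_support) (hc2c' hgc₂)
            (List.mem_toFinset.2 h)
        · exact hc2c' (hπc x (hπgsub x h))
      have hKa₂ : Disjoint K a₂ := by
        refine Finset.disjoint_left.2 fun v hv hva => ?_
        rcases hKmem.1 hv with h | h
        · exact hdj (hβsub v h) (mem₂.1 hva)
        · have hve : v = e := hπa₂ v (hπgsub v h) (mem₂.1 hva)
          exact heπg (hve ▸ h)
      have hz₂w₂ : Q.ht z₂ < Q.ht w₂ := by
        rcases lt_trichotomy (Q.ht z₂) (Q.ht w₂) with hh | hh | hh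
        · exact hh
        · exfalso
          have hzw : z₂ = w₂ := Q.ht_injOn (Finset.mem_coe.2 hc₂.tip_mem_J) (Finset.mem_coe.2 ha₂.tip_mem_J) hh
          -- then `π` starts on `α₂`, so `e = z₂` and `π` is trivial: `g = z₂ = w₂ ∈ α₁ ∩ α₂`
          have hz₂α : z₂ ∈ α₂.support := by rw [hzw]; exact α₂.end_mem_support
          have hz₂e : z₂ = e := hπa₂ z₂ π.start_mem_support hz₂α
          -- `π` is then a path from `e` to `e`, trivial, so `g = e`
          subst hz₂e
          exact hge (eq_of_mem_support_of_isPath_loop hπpath hgπ)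
        · exfalso
          have : z₂ ∈ Q.above a₂ w₂ := ha₂.mem_above_of_mem_Jabove (mem_Jabove.2 ⟨hc₂.tip_mem_J, hh⟩)
          exact (mem_lower_iff_not_mem_above hc₂.tip_mem_D).1 (hL₂ hc₂.tip_mem) this
      have := disjoint_of_stage_crossing_same_tip hcut hdual hu₂ hK hKω hKabove ha₂ hKa₂ hz₂w₂
      exact Finset.disjoint_left.1 this hx₂a hx₂c
    -- `h` = the last vertex of `β` on `c'`
    obtain ⟨h, γ, γ', hβeq, hhL, hhlast⟩ := exists_append_last_mem (↑c' : Set (Site 2)) β hβc'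
    have hhc' : h ∈ c' := Finset.mem_coe.1 hhL
    have hγsub : ∀ v ∈ γ.support, v ∈ β.support := fun v hv => by rw [hβeq]; exact support_subset_support_append_left γ γ' v hv
    have hγpath : (γ.append γ').IsPath := by rw [← hβeq]; exact (isPath_append_iff'.1 hβpath).1
    have hhg : h ≠ g := fun hh => Finset.disjoint_left.1 hc'c₂ hhc' (hh ▸ hgc₂)
    have hgγ : g ∉ γ.support := fun hg => hhg (eq_of_mem_support_of_isPath_append hγpath hg γ'.end_mem_support).symm
    -- a path inside `c'` from `h` to its tip
    obtain ⟨ρ, -, hρc⟩ := exists_isPath_of_pathIn (hc'.conn h hhc' z' hc'.tip_mem)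
    set P₁ : Finset (Site 2) := γ.support.toFinset ∪ ρ.support.toFinset with hP₁
    have hP₁mem : ∀ {v}, v ∈ P₁ ↔ v ∈ γ.support ∨ v ∈ ρ.support := fun {v} => by
      rw [hP₁, Finset.mem_union, List.mem_toFinset, List.mem_toFinset]
    have hP₂mem : ∀ {v}, v ∈ P₂ ↔ v ∈ β₂.support ∨ v ∈ π.support := fun {v} => by
      rw [hP₂, Finset.mem_union, List.mem_toFinset, List.mem_toFinset]
    refine ⟨u', c', z', hu', Nat.lt_succ_self u', ⟨h, Finset.mem_inter.2 ⟨mem₁.2 (hβsub h (hγsub h γ.end_mem_support)), hhc'⟩⟩,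
      subset_above_of_forall_disjoint ha₂ ha₂ω u' (fun v hv c'' z'' hseq => hmin₂ v (Nat.lt_succ_of_le hv) c'' z'' hseq) c' z' hu',
      hc2c', P₁, P₂, ?_, ?_, hP₂sub, ?_, hP₂path⟩
    · -- disjointness
      refine Finset.disjoint_left.2 fun v hv₁ hv₂ => ?_
      rcases hP₁mem.1 hv₁ with h1 | h1 <;> rcases hP₂mem.1 hv₂ with h2 | h2
      · exact hdj (hβsub v (hγsub v h1)) (α₂.support_takeUntil_subset_support hea' h2)
      · -- a vertex of `γ` on `π`: it is on `β`, hence it is `g`, which is not on `γ`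
        have hvg : v = g := hgfirst v (hγsub v h1) h2
        exact hgγ (hvg ▸ h1)
      · exact Finset.disjoint_left.1 hc'a₂ (mem₂.2 (α₂.support_takeUntil_subset_support hea' h2)) (hρc v h1)
      · exact Finset.disjoint_left.1 hc'c₂ (hρc v h1) (hπc v h2)
    · intro v hv
      rcases hP₁mem.1 hv with h1 | h1
      · exact Finset.mem_union_left _ (mem₁.2 (hβsub v (hγsub v h1)))
      · exact Finset.mem_union_right _ (hρc v h1)
    · refine PathIn.of_walk (γ.append ρ) fun v hv => ?_
      rw [SimpleGraph.Walk.mem_support_append_iff] at hv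
      exact Finset.mem_coe.2 (hP₁mem.2 hv)
  · ------------------------------------------------------------------------------------------
    -- CASE: `π` misses `α₁`; reroute `α₁` along `c₁`
    ------------------------------------------------------------------------------------------
    push Not at hhit
    obtain ⟨x₁, hx₁⟩ := hmeet₁
    have hx₁a : x₁ ∈ a₁ := (Finset.mem_inter.1 hx₁).1
    have hx₁c : x₁ ∈ c₁ := (Finset.mem_inter.1 hx₁).2
    obtain ⟨ρ₀, -, hρ₀c⟩ := exists_isPath_of_pathIn (hc₁.conn z₁ hc₁.tip_mem x₁ hx₁c)
    obtain ⟨e₁, ρ, ρr, hρeq, he₁L, -⟩ := exists_append_first_mem (↑a₁ : Set (Site 2)) ρ₀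
      ⟨x₁, ρ₀.end_mem_support, Finset.mem_coe.2 hx₁a⟩
    have he₁a : e₁ ∈ a₁ := Finset.mem_coe.1 he₁L
    have he₁a' : e₁ ∈ α₁.support := mem₁.1 he₁a
    have hρc : ∀ v ∈ ρ.support, v ∈ c₁ := fun v hv => hρ₀c v (by rw [hρeq]; exact support_subset_support_append_left ρ ρr v hv)
    set β₁ := α₁.takeUntil e₁ he₁a' with hβ₁
    set P₁ : Finset (Site 2) := β₁.support.toFinset ∪ ρ.support.toFinset with hP₁
    have hP₁mem : ∀ {v}, v ∈ P₁ ↔ v ∈ β₁.support ∨ v ∈ ρ.support := fun {v} => by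
      rw [hP₁, Finset.mem_union, List.mem_toFinset, List.mem_toFinset]
    have hP₂mem : ∀ {v}, v ∈ P₂ ↔ v ∈ β₂.support ∨ v ∈ π.support := fun {v} => by
      rw [hP₂, Finset.mem_union, List.mem_toFinset, List.mem_toFinset]
    refine ⟨u₁, c₁, z₁, hu₁, hu12, ⟨x₁, hx₁⟩, h2c₁, hc2c1, P₁, P₂, ?_, ?_, hP₂sub, ?_, hP₂path⟩
    · refine Finset.disjoint_left.2 fun v hv₁ hv₂ => ?_
      rcases hP₁mem.1 hv₁ with h1 | h1 <;> rcases hP₂mem.1 hv₂ with h2 | h2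
      · exact hdj (α₁.support_takeUntil_subset_support he₁a' h1) (α₂.support_takeUntil_subset_support hea' h2)
      · exact hhit v h2 (α₁.support_takeUntil_subset_support he₁a' h1)
      · exact Finset.disjoint_left.1 hd21 (mem₂.2 (α₂.support_takeUntil_subset_support hea' h2)) (hρc v h1)
      · exact Finset.disjoint_left.1 hc12 (hρc v h1) (hπc v h2)
    · intro v hv
      rcases hP₁mem.1 hv with h1 | h1
      · exact Finset.mem_union_left _ (mem₁.2 (α₁.support_takeUntil_subset_support he₁a' h1))
      · exact Finset.mem_union_right _ (hρc v h1)
    · refine PathIn.of_walk (β₁.append ρ.reverse) fun v hv => ?_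
      rw [SimpleGraph.Walk.mem_support_append_iff] at hv
      rw [Finset.mem_coe]
      refine hP₁mem.2 ?_
      rcases hv with h | h
      · exact Or.inl h
      · right; rwa [SimpleGraph.Walk.support_reverse, List.mem_reverse] at h

/-- **Disjoint rerouting, structured form** (for the fence attachment and the excursion analysis of
the concrete separation step): the same recipe as `pair_reroute`, with the path `π₀` inside `c_{u₂}`
from its tip to a site of `α₂` GIVEN (so that it can be routed through prescribed sites), the lower
crossing cut at its FIRST vertex on the lower term in the case where `π` misses `α₁`, and the pieces
exposed: `π₀ = π ++ πr` cut at the first vertex `e` of `α₂`, `α₁ = β ++ β'` cut at a vertex `y` of the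
lower term `c`, a path `ρ` inside `c` from `y` to its tip, `β` off `π`, and
`(β ∪ ρ) ∩ (α₂[s₂ → e] ∪ π) = ∅`. [cite: Nolin2008, §4.4 (arXiv 0711.4948: proof of Lemma 14, last paragraph)] -/
theorem pair_reroute' (hcut : Q.CutProp) (hdual : Q.DualProp) {ω : Set (Site 2)}
    {s₁ w₁ s₂ w₂ : Site 2} (α₁ : triGraph.Walk s₁ w₁) (α₂ : triGraph.Walk s₂ w₂)
    (hα₁ : α₁.IsPath)
    (ha₁ : Q.IsCrossing α₁.support.toFinset w₁) (ha₂ : Q.IsCrossing α₂.support.toFinset w₂)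
    (hs₁ : s₁ ∈ Q.F)
    (ha₁ω : (↑α₁.support.toFinset : Set (Site 2)) ⊆ ω) (ha₂ω : (↑α₂.support.toFinset : Set (Site 2)) ⊆ ω)
    (hdisj : Disjoint α₁.support.toFinset α₂.support.toFinset) (hlt : Q.ht w₁ < Q.ht w₂)
    {u₁ u₂ : ℕ} {c₁ c₂ : Finset (Site 2)} {z₁ z₂ : Site 2}
    (hu₁ : Q.lowestSeq ω u₁ = some (c₁, z₁)) (hmeet₁ : (α₁.support.toFinset ∩ c₁).Nonempty)
    (hmin₁ : ∀ v < u₁, ∀ c z, Q.lowestSeq ω v = some (c, z) → Disjoint α₁.support.toFinset c)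
    (hu₂ : Q.lowestSeq ω u₂ = some (c₂, z₂))
    (hmin₂ : ∀ v < u₂, ∀ c z, Q.lowestSeq ω v = some (c, z) → Disjoint α₂.support.toFinset c)
    {x₂ : Site 2} (π₀ : triGraph.Walk z₂ x₂) (hπ₀ : π₀.IsPath) (hπ₀c : ∀ v ∈ π₀.support, v ∈ c₂)
    (hx₂a : x₂ ∈ α₂.support) :
    ∃ (u : ℕ) (c : Finset (Site 2)) (z : Site 2), Q.lowestSeq ω u = some (c, z) ∧ u < u₂ ∧
      α₂.support.toFinset ⊆ Q.above c z ∧ c₂ ⊆ Q.above c z ∧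
      ∃ (e : Site 2) (π : triGraph.Walk z₂ e) (πr : triGraph.Walk e x₂) (he : e ∈ α₂.support)
        (y : Site 2) (β : triGraph.Walk s₁ y) (β' : triGraph.Walk y w₁) (ρ : triGraph.Walk y z),
        π₀ = π.append πr ∧ (∀ v ∈ π.support, v ∈ α₂.support → v = e) ∧
        α₁ = β.append β' ∧ y ∈ c ∧ (∀ v ∈ ρ.support, v ∈ c) ∧ (∀ v ∈ β.support, v ∉ π.support) ∧
        Disjoint (β.support.toFinset ∪ ρ.support.toFinset)
          ((α₂.takeUntil e he).support.toFinset ∪ π.support.toFinset) := by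
  classical
  set a₁ := α₁.support.toFinset with ha₁def
  set a₂ := α₂.support.toFinset with ha₂def
  have mem₁ : ∀ {x}, x ∈ a₁ ↔ x ∈ α₁.support := fun {x} => List.mem_toFinset
  have mem₂ : ∀ {x}, x ∈ a₂ ↔ x ∈ α₂.support := fun {x} => List.mem_toFinset
  have hdj : ∀ {x}, x ∈ α₁.support → x ∉ α₂.support := fun {x} h1 h2 =>
    Finset.disjoint_left.1 hdisj (mem₁.2 h1) (mem₂.2 h2)
  have hmeet₂ : (a₂ ∩ c₂).Nonempty := ⟨x₂, Finset.mem_inter.2 ⟨mem₂.2 hx₂a, hπ₀c x₂ π₀.end_mem_support⟩⟩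
  obtain ⟨h21, -, hA₁, hd21, h2c₁, hL₂, hu12⟩ :=
    pair_min_terms hcut hdual ha₁ ha₁ω ha₂ ha₂ω hdisj hlt hu₁ hmin₁ hu₂ hmeet₂ hmin₂
  obtain ⟨hc₁, hc₁ω⟩ := isCrossing_of_lowestSeq hu₁
  obtain ⟨hc₂, hc₂ω⟩ := isCrossing_of_lowestSeq hu₂
  have hc12 : Disjoint c₁ c₂ := lowestSeq_disjoint_of_lt hcut hu12 hu₁ hu₂
  have hc2c1 : c₂ ⊆ Q.above c₁ z₁ := lowestSeq_subset_above_of_lt hcut hu12 hu₁ hu₂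
  have hx₂c : x₂ ∈ c₂ := hπ₀c x₂ π₀.end_mem_support
  -- cut `π₀` at its first vertex of `α₂`
  obtain ⟨e, π, πr, hπeq, heL, hefirst⟩ := exists_append_first_mem (↑a₂ : Set (Site 2)) π₀
    ⟨x₂, π₀.end_mem_support, Finset.mem_coe.2 (mem₂.2 hx₂a)⟩
  have hea : e ∈ a₂ := Finset.mem_coe.1 heL
  have hea' : e ∈ α₂.support := mem₂.1 hea
  have hπsub : ∀ v ∈ π.support, v ∈ π₀.support := fun v hv => by rw [hπeq]; exact support_subset_support_append_left π πr v hv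
  have hπc : ∀ v ∈ π.support, v ∈ c₂ := fun v hv => hπ₀c v (hπsub v hv)
  have hπpath : π.IsPath := by rw [hπeq] at hπ₀; exact (isPath_append_iff'.1 hπ₀).1
  have hπa₂ : ∀ v ∈ π.support, v ∈ α₂.support → v = e := fun v hv hva => hefirst v hv (Finset.mem_coe.2 (mem₂.2 hva))
  set β₂ := α₂.takeUntil e hea' with hβ₂
  ----------------------------------------------------------------------------------------------
  by_cases hhit : ∃ y ∈ π.support, y ∈ α₁.support
  · -- `π` meets `α₁`
    obtain ⟨g, β, β', hαeq, hgL, hgfirst⟩ := exists_append_first_mem {v : Site 2 | v ∈ π.support} α₁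
      (by obtain ⟨y, hy, hya⟩ := hhit; exact ⟨y, hya, hy⟩)
    have hgπ : g ∈ π.support := hgL
    have hβsub : ∀ v ∈ β.support, v ∈ α₁.support := fun v hv => by rw [hαeq]; exact support_subset_support_append_left β β' v hv
    have hβpath : (β.append β').IsPath := by rw [← hαeq]; exact hα₁
    have hga₁ : g ∈ α₁.support := hβsub g β.end_mem_support
    have hge : g ≠ e := fun h => hdj hga₁ (h ▸ hea')
    have hgc₂ : g ∈ c₂ := hπc g hgπ
    obtain ⟨u', rfl⟩ : ∃ u', u₂ = u' + 1 := ⟨u₂ - 1, by omega⟩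
    obtain ⟨⟨c', z'⟩, hu'⟩ := exists_lowestSeq_eq_some_of_succ hu₂
    obtain ⟨hc', hc'ω⟩ := isCrossing_of_lowestSeq hu'
    have hc2c' : c₂ ⊆ Q.above c' z' := (lowestSeq_succ_subset_above hcut hu' hu₂).1
    have hc'c₂ : Disjoint c' c₂ := lowestSeq_disjoint_of_lt hcut (Nat.lt_succ_self u') hu' hu₂
    have hc'a₂ : Disjoint a₂ c' := hmin₂ u' (Nat.lt_succ_self u') c' z' hu'
    -- the initial segment `β` meets `c'` (by `pair_reroute`'s obstruction argument, repeated)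
    have hβc' : ∃ y ∈ β.support, y ∈ (↑c' : Set (Site 2)) := by
      by_contra hno
      push Not at hno
      have hβdisj : Disjoint β.support.toFinset c' :=
        Finset.disjoint_left.2 fun v hv hvc => hno v (List.mem_toFinset.1 hv) (Finset.mem_coe.2 hvc)
      set πg := π.takeUntil g hgπ with hπg
      have hπgsub : ∀ v ∈ πg.support, v ∈ π.support := fun v hv => π.support_takeUntil_subset_support hgπ hv
      have heπg : e ∉ πg.support := by
        intro h
        have hsp := π.take_spec hgπ
        have hp : (πg.append (π.dropUntil g hgπ)).IsPath := by rw [hπg, hsp]; exact hπpath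
        exact hge (eq_of_mem_support_of_isPath_append hp h (π.dropUntil g hgπ).end_mem_support).symm
      set K : Finset (Site 2) := β.support.toFinset ∪ πg.support.toFinset with hK
      have hKmem : ∀ {v}, v ∈ K ↔ v ∈ β.support ∨ v ∈ πg.support := fun {v} => by
        rw [hK, Finset.mem_union, List.mem_toFinset, List.mem_toFinset]
      have hKD : K ⊆ Q.D := fun v hv => by
        rcases hKmem.1 hv with h | h
        · exact ha₁.subset (mem₁.2 (hβsub v h))
        · exact hc₂.subset (hπc v (hπgsub v h))
      have hKconn : ∀ x ∈ K, ∀ y ∈ K, PathIn triGraph (↑K : Set (Site 2)) x y := by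
        have toG : ∀ x ∈ K, PathIn triGraph (↑K : Set (Site 2)) x g := by
          intro x hx
          rcases hKmem.1 hx with h | h
          · exact (PathIn.of_walk_mem_support β (fun v hv => Finset.mem_coe.2 (hKmem.2 (Or.inl hv))) h).2
          · exact (PathIn.of_walk_mem_support πg (fun v hv => Finset.mem_coe.2 (hKmem.2 (Or.inr hv))) h).2
        exact fun x hx y hy => (toG x hx).trans (toG y hy).symm
      have hK : Q.IsCrossing K z₂ :=
        { subset := hKD
          tip_mem := hKmem.2 (Or.inr πg.start_mem_support)
          tip_mem_J := hc₂.tip_mem_J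
          eq_tip := by
            intro v hv hvJ
            rcases hKmem.1 hv with h | h
            · have hvw : v = w₁ := ha₁.eq_tip v (mem₁.2 (hβsub v h)) hvJ
              subst hvw
              have hvg : v = g := eq_of_mem_support_of_isPath_append hβpath h β'.end_mem_support
              rw [hvg] at hvJ ⊢
              exact hc₂.eq_tip g hgc₂ hvJ
            · exact hc₂.eq_tip v (hπc v (hπgsub v h)) hvJ
          exists_start := ⟨s₁, hKmem.2 (Or.inl β.start_mem_support), hs₁⟩
          conn := hKconn }
      have hKω : (↑K : Set (Site 2)) ⊆ ω := by
        intro v hv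
        rcases hKmem.1 (Finset.mem_coe.1 hv) with h | h
        · exact ha₁ω (Finset.mem_coe.2 (mem₁.2 (hβsub v h)))
        · exact hc₂ω (Finset.mem_coe.2 (hπc v (hπgsub v h)))
      have hKabove : ∀ v c'' z'', v + 1 = u' + 1 → Q.lowestSeq ω v = some (c'', z'') → K ⊆ Q.above c'' z'' := by
        intro v c'' z'' hv hseq
        have hvu : v = u' := by omega
        subst hvu
        rw [hu'] at hseq
        obtain ⟨rfl, rfl⟩ := Prod.mk.inj (Option.some.inj hseq)
        intro x hx
        rcases hKmem.1 hx with h | h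
        · have hβD : β.support.toFinset ⊆ Q.D := fun v hv => ha₁.subset (mem₁.2 (hβsub v (List.mem_toFinset.1 hv)))
          have hβconn : ∀ x ∈ β.support.toFinset, ∀ y ∈ β.support.toFinset,
              PathIn triGraph (↑β.support.toFinset : Set (Site 2)) x y := by
            intro x hx y hy
            have px := (PathIn.of_walk_mem_support β (fun v hv => Finset.mem_coe.2 (List.mem_toFinset.2 hv)) (List.mem_toFinset.1 hx)).1
            have py := (PathIn.of_walk_mem_support β (fun v hv => Finset.mem_coe.2 (List.mem_toFinset.2 hv)) (List.mem_toFinset.1 hy)).1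
            exact px.symm.trans py
          exact hc'.subset_above_of_mem hβD hβconn hβdisj (List.mem_toFinset.2 β.end_mem_support) (hc2c' hgc₂)
            (List.mem_toFinset.2 h)
        · exact hc2c' (hπc x (hπgsub x h))
      have hKa₂ : Disjoint K a₂ := by
        refine Finset.disjoint_left.2 fun v hv hva => ?_
        rcases hKmem.1 hv with h | h
        · exact hdj (hβsub v h) (mem₂.1 hva)
        · have hve : v = e := hπa₂ v (hπgsub v h) (mem₂.1 hva)
          exact heπg (hve ▸ h)
      have hz₂w₂ : Q.ht z₂ < Q.ht w₂ := by
        rcases lt_trichotomy (Q.ht z₂) (Q.ht w₂) with hh | hh | hh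
        · exact hh
        · exfalso
          have hzw : z₂ = w₂ := Q.ht_injOn (Finset.mem_coe.2 hc₂.tip_mem_J) (Finset.mem_coe.2 ha₂.tip_mem_J) hh
          have hz₂α : z₂ ∈ α₂.support := by rw [hzw]; exact α₂.end_mem_support
          have hz₂e : z₂ = e := hπa₂ z₂ π.start_mem_support hz₂α
          subst hz₂e
          exact hge (eq_of_mem_support_of_isPath_loop hπpath hgπ)
        · exfalso
          have : z₂ ∈ Q.above a₂ w₂ := ha₂.mem_above_of_mem_Jabove (mem_Jabove.2 ⟨hc₂.tip_mem_J, hh⟩)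
          exact (mem_lower_iff_not_mem_above hc₂.tip_mem_D).1 (hL₂ hc₂.tip_mem) this
      have := disjoint_of_stage_crossing_same_tip hcut hdual hu₂ hK hKω hKabove ha₂ hKa₂ hz₂w₂
      obtain ⟨x, hx⟩ := hmeet₂
      exact Finset.disjoint_left.1 this (Finset.mem_inter.1 hx).1 (Finset.mem_inter.1 hx).2
    obtain ⟨h, γ, γ', hβeq, hhL, -⟩ := exists_append_last_mem (↑c' : Set (Site 2)) β hβc'
    have hhc' : h ∈ c' := Finset.mem_coe.1 hhL
    have hγsub : ∀ v ∈ γ.support, v ∈ β.support := fun v hv => by rw [hβeq]; exact support_subset_support_append_left γ γ' v hv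
    have hγpath : (γ.append γ').IsPath := by rw [← hβeq]; exact (isPath_append_iff'.1 hβpath).1
    have hhg : h ≠ g := fun hh => Finset.disjoint_left.1 hc'c₂ hhc' (hh ▸ hgc₂)
    have hgγ : g ∉ γ.support := fun hg => hhg (eq_of_mem_support_of_isPath_append hγpath hg γ'.end_mem_support).symm
    obtain ⟨ρ, -, hρc⟩ := exists_isPath_of_pathIn (hc'.conn h hhc' z' hc'.tip_mem)
    have hγπ : ∀ v ∈ γ.support, v ∉ π.support := fun v hv hvπ => hgγ ((hgfirst v (hγsub v hv) hvπ) ▸ hv)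
    refine ⟨u', c', z', hu', Nat.lt_succ_self u',
      subset_above_of_forall_disjoint ha₂ ha₂ω u' (fun v hv c'' z'' hseq => hmin₂ v (Nat.lt_succ_of_le hv) c'' z'' hseq) c' z' hu',
      hc2c', e, π, πr, hea', h, γ, γ'.append β', ρ, hπeq, hπa₂, ?_, hhc', hρc, hγπ, ?_⟩
    · rw [hαeq, hβeq, SimpleGraph.Walk.append_assoc]
    · refine Finset.disjoint_left.2 fun v hv₁ hv₂ => ?_
      rw [Finset.mem_union, List.mem_toFinset, List.mem_toFinset] at hv₁ hv₂
      rcases hv₁ with h1 | h1 <;> rcases hv₂ with h2 | h2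
      · exact hdj (hβsub v (hγsub v h1)) (α₂.support_takeUntil_subset_support hea' h2)
      · exact hγπ v h1 h2
      · exact Finset.disjoint_left.1 hc'a₂ (mem₂.2 (α₂.support_takeUntil_subset_support hea' h2)) (hρc v h1)
      · exact Finset.disjoint_left.1 hc'c₂ (hρc v h1) (hπc v h2)
  · -- `π` misses `α₁`: cut `α₁` at its FIRST vertex of `c₁`
    push Not at hhit
    obtain ⟨y, β, β', hαeq, hyL, -⟩ := exists_append_first_mem (↑c₁ : Set (Site 2)) α₁
      (by obtain ⟨x, hx⟩ := hmeet₁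
          exact ⟨x, mem₁.1 (Finset.mem_inter.1 hx).1, Finset.mem_coe.2 (Finset.mem_inter.1 hx).2⟩)
    have hyc : y ∈ c₁ := Finset.mem_coe.1 hyL
    have hβsub : ∀ v ∈ β.support, v ∈ α₁.support := fun v hv => by rw [hαeq]; exact support_subset_support_append_left β β' v hv
    obtain ⟨ρ, -, hρc⟩ := exists_isPath_of_pathIn (hc₁.conn y hyc z₁ hc₁.tip_mem)
    have hβπ : ∀ v ∈ β.support, v ∉ π.support := fun v hv hvπ => hhit v hvπ (hβsub v hv)
    refine ⟨u₁, c₁, z₁, hu₁, hu12, h2c₁, hc2c1, e, π, πr, hea', y, β, β', ρ, hπeq, hπa₂, hαeq, hyc, hρc, hβπ, ?_⟩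
    refine Finset.disjoint_left.2 fun v hv₁ hv₂ => ?_
    rw [Finset.mem_union, List.mem_toFinset, List.mem_toFinset] at hv₁ hv₂
    rcases hv₁ with h1 | h1 <;> rcases hv₂ with h2 | h2
    · exact hdj (hβsub v h1) (α₂.support_takeUntil_subset_support hea' h2)
    · exact hβπ v h1 h2
    · exact Finset.disjoint_left.1 hd21 (mem₂.2 (α₂.support_takeUntil_subset_support hea' h2)) (hρc v h1)
    · exact Finset.disjoint_left.1 hc12 (hρc v h1) (hπc v h2)

end JDomain

end Literature.Probability.Percolation
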